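import Mathlib
import Literature.Analysis.FluidPDE.AxisymmetricEuler
import Literature.Analysis.FluidPDE.SwirlTransportProofs
import Literature.Analysis.FluidPDE.AxisymVorticityAlgebra
import Literature.Analysis.FluidPDE.VectorCalculus
import Literature.Analysis.FluidPDE.VorticityCalculus
import Literature.Analysis.FluidPDE.WholeSpaceIBP
import Literature.Analysis.FluidPDE.AxisymHouLiVariables
import Summits.NavierStokesRegularity.NavierStokesRegularity.Theorems.PoloidalWindowDoorPoloidalWindowRigidityConstantShearMeans
import HarnessLib

/-!
# Crux `EulerZoomLiouville.PowerGaugeEulerLiouville` (stmt-NavierStokesRegularity-19832), line `mirror-moment`, towards stub M1: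
# THE AXIAL FLUX SIGN LEMMA, part 1 — pointwise Cartesian identities (the integrand `v₂ · (r ω_θ)/(r²+ε²)` of an axisymmetric
# swirl-free divergence-free field is a sum of two squares plus exact derivatives)

Route №10 `EulerZoomLiouville` (NavierStokesRegularity), crux E.  Line `mirror-moment` (ideator ns-idea-11 g3;
`Cruxes/PowerGaugeEulerLiouville/Lines/mirror_moment.lean`), lever M1 `stub_momentMonotone` (the axial ledger moment
`∫ |x₂| · |curl u|/r dx` of a classical mirror-outgoing swirl-free member is non-decreasing).  Its analytic core is the SIGN of the
axial vorticity flux `∫ u₂ · ω_θ/r dx = 2π ∬ u_z ω_θ dr dz = π ∫_{axis} u_z² dz + ∫ u_r²/r² dx ≥ 0` (Choi–Jeong, AJM 2025 = arXiv:2110.09079,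
Lemma 3.3, time-reversed orientation; Iftimie–Sideris–Gamblin 1999 planar ancestor).  This file is the CARTESIAN, coordinate-free-of-`θ`
pointwise bookkeeping behind a proof that never leaves `ℝ³` (no meridional half-plane, no axis boundary term): with
`r² = x₀² + x₁²`, `q_ε = (r² + ε²)⁻¹`, `f = v₂`, `h = x₀v₀ + x₁v₁ = r v_r`, `s = swirl (curl v) = x₀ω₁ − x₁ω₀ = r ω_θ`, and a scalar test
function `χ`, the integrand `χ q_ε f s` equals

  `χ q_ε² (ε² f² + r² (v₀² + v₁²))`                                           — two squares,
  `+ q_ε (∂_{x_h}χ) (f² − v₀² − v₁²)/2 − q_ε h f ∂₂χ`                          — cut-off errors,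
  `+ ∂₂(χ q_ε f h) + div(χ q_ε (v₀²+v₁²)/2 · x_h) − div(χ q_ε f²/2 · x_h)`     — exact derivatives (`x_h = (x₀, x₁, 0)`),

using only: `s = ∂₂h − ∂_{x_h} f` (coordinates of the curl), `div v = 0`, and the two infinitesimal consequences of axisymmetry without
swirl, `Dv(x)[Jx] = J v(x)` (`IsAxisymmetric.fderiv_rotGen`) and `x₀v₁ = x₁v₀`, which together give the key identity
`h (∂₀v₀ + ∂₁v₁) = v₀² + v₁² + ½ ∂_{x_h}(v₀² + v₁²)` (`horizontal_key_identity`).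

* bookkeeping of the horizontal position field `x_h = x₀e₀ + x₁e₁` (as explicit vectors, no new definitions): `fderiv_horizontal`,
  `hasFDerivAt_horizontal`, `divergence_horizontal`, `divergence_weighted_horizontal`, `fderiv_weighted_product_two`;
* `swirl_curl_eq` — `s = (x₀∂₂v₀ + x₁∂₂v₁) − (x₀∂₀v₂ + x₁∂₁v₂)`;
* `horizontal_key_identity` — the axisymmetric swirl-free identity above;
* `fderiv_invSq` — `D q_ε(x) w = −2 (x₀w₀ + x₁w₁) q_ε²` (so `∂_{x_h} q_ε = −2 r² q_ε²`, `∂₂ q_ε = 0`);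
* `axialFlux_integrand_decomposition` — the displayed pointwise decomposition.

WHAT THIS IS NOT: not NS, not the crux — real-variable bookkeeping `--supports` stmt-19832 for the line `mirror-moment` (M1 is NOT proved
here; part 2 integrates this identity and passes to the limit); nothing here bears on NS regularity.
[cite: ChoiJeong2025, Lemma 3.3 (arXiv:2110.09079 p. 12); folklore (vector calculus)]
-/

noncomputable section

-- flat `Theorems/<Route><Decl>…` files of one crux share the namespace of the crux (tree convention)
set_option linter.dupNamespace false

open MeasureTheory Set Filter Topology Metric Function
open scoped NNReal ENNReal RealInnerProductSpace

namespace Summit.NavierStokesRegularity.NavierStokesRegularity.Theorems.PowerGaugeEulerLiouville.MirrorMoment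

open Literature.Analysis Literature.Analysis.FluidPDE
open Summit.NavierStokesRegularity.NavierStokesRegularity.Theorems.PoloidalWindowDoorPoloidalWindowRigidityConstantShearMeans (fderiv_coord_apply)

/-! ### The standard basis and the horizontal position field -/

/-- The horizontal position vector `(x₀, x₁, 0) = x₀ e₀ + x₁ e₁` has components `x₀, x₁, 0`. [folklore] -/
theorem horizontal_apply (x : EuclideanSpace ℝ (Fin 3)) :
    ((x 0) • EuclideanSpace.single 0 (1 : ℝ) + (x 1) • EuclideanSpace.single 1 (1 : ℝ) : EuclideanSpace ℝ (Fin 3)) 0 = x 0 ∧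
    ((x 0) • EuclideanSpace.single 0 (1 : ℝ) + (x 1) • EuclideanSpace.single 1 (1 : ℝ) : EuclideanSpace ℝ (Fin 3)) 1 = x 1 ∧
    ((x 0) • EuclideanSpace.single 0 (1 : ℝ) + (x 1) • EuclideanSpace.single 1 (1 : ℝ) : EuclideanSpace ℝ (Fin 3)) 2 = 0 := by
  refine ⟨?_, ?_, ?_⟩ <;> simp

/-- Coordinate functions are smooth. [folklore] -/
theorem contDiff_coord {n : WithTop ℕ∞} (i : Fin 3) : ContDiff ℝ n (fun y : EuclideanSpace ℝ (Fin 3) => y i) := by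
  have h : (fun y : EuclideanSpace ℝ (Fin 3) => y i) = (EuclideanSpace.proj (𝕜 := ℝ) i) := by
    ext y; simp
  rw [h]
  exact (EuclideanSpace.proj (𝕜 := ℝ) i).contDiff

/-- Components of a `C¹` field are `C¹`. [folklore] -/
theorem contDiff_apply_coord {v : EuclideanSpace ℝ (Fin 3) → EuclideanSpace ℝ (Fin 3)} {n : WithTop ℕ∞} (hv : ContDiff ℝ n v)
    (i : Fin 3) : ContDiff ℝ n (fun y => v y i) := by
  have h : (fun y => v y i) = (EuclideanSpace.proj (𝕜 := ℝ) i) ∘ v := by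
    ext y; simp
  rw [h]
  exact (EuclideanSpace.proj (𝕜 := ℝ) i).contDiff.comp hv

/-- Linearity of `Dv(x)` along the horizontal position vector: `(Dv(x)[x₀e₀ + x₁e₁]) i = x₀ ∂₀vᵢ + x₁ ∂₁vᵢ`. [folklore] -/
theorem fderiv_horizontal {v : EuclideanSpace ℝ (Fin 3) → EuclideanSpace ℝ (Fin 3)} (x : EuclideanSpace ℝ (Fin 3)) (i : Fin 3) :
    fderiv ℝ v x ((x 0) • EuclideanSpace.single 0 (1 : ℝ) + (x 1) • EuclideanSpace.single 1 (1 : ℝ)) i =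
      x 0 * fderiv ℝ v x (EuclideanSpace.single 0 (1 : ℝ)) i + x 1 * fderiv ℝ v x (EuclideanSpace.single 1 (1 : ℝ)) i := by
  rw [map_add, map_smul, map_smul]
  simp

/-! ### The curl in the swirl direction -/

/-- **The swirl of the curl in coordinates**: `x₀ω₁ − x₁ω₀ = (x₀∂₂v₀ + x₁∂₂v₁) − (x₀∂₀v₂ + x₁∂₁v₂)`, i.e.
`r ω_θ = ∂₂(r v_r) − ∂_{x_h} v₂` (`∂ⱼvᵢ = (Dv(x) eⱼ) i`). [folklore] -/
theorem swirl_curl_eq (v : EuclideanSpace ℝ (Fin 3) → EuclideanSpace ℝ (Fin 3)) (x : EuclideanSpace ℝ (Fin 3)) :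
    swirl (curl v) x =
      (x 0 * fderiv ℝ v x (EuclideanSpace.single 2 (1 : ℝ)) 0 + x 1 * fderiv ℝ v x (EuclideanSpace.single 2 (1 : ℝ)) 1) -
        (x 0 * fderiv ℝ v x (EuclideanSpace.single 0 (1 : ℝ)) 2 + x 1 * fderiv ℝ v x (EuclideanSpace.single 1 (1 : ℝ)) 2) := by
  have h0 : curl v x 0 = fderiv ℝ v x (EuclideanSpace.single 1 1) 2 - fderiv ℝ v x (EuclideanSpace.single 2 1) 1 := by
    simp [FluidPDE.curl]
  have h1 : curl v x 1 = fderiv ℝ v x (EuclideanSpace.single 2 1) 0 - fderiv ℝ v x (EuclideanSpace.single 0 1) 2 := by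
    simp [FluidPDE.curl]
  rw [swirl, h0, h1]
  ring

/-! ### The key axisymmetric swirl-free identity -/

/-- **The key identity of axisymmetry without swirl** (pointwise): with `h = x₀v₀ + x₁v₁`,
`h (∂₀v₀ + ∂₁v₁) = v₀² + v₁² + v₀ ∂_{x_h}v₀ + v₁ ∂_{x_h}v₁`, where `∂_{x_h} = x₀∂₀ + x₁∂₁`; from `Dv(x)[Jx] = J v(x)` (two components) and
`x₀v₁ = x₁v₀`.  In cylindrical words: `r v_r (∂ᵣv_r + v_r/r) = v_r² + r v_r ∂ᵣ v_r`. [folklore] -/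
theorem horizontal_key_identity {v : EuclideanSpace ℝ (Fin 3) → EuclideanSpace ℝ (Fin 3)} (hax : IsAxisymmetric v) (hsw : HasNoSwirl v)
    {x : EuclideanSpace ℝ (Fin 3)} (hd : DifferentiableAt ℝ v x) :
    (x 0 * v x 0 + x 1 * v x 1) * (fderiv ℝ v x (EuclideanSpace.single 0 1) 0 + fderiv ℝ v x (EuclideanSpace.single 1 1) 1) =
      (v x 0 ^ 2 + v x 1 ^ 2) +
        (v x 0 * (x 0 * fderiv ℝ v x (EuclideanSpace.single 0 1) 0 + x 1 * fderiv ℝ v x (EuclideanSpace.single 1 1) 0) +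
          v x 1 * (x 0 * fderiv ℝ v x (EuclideanSpace.single 0 1) 1 + x 1 * fderiv ℝ v x (EuclideanSpace.single 1 1) 1)) := by
  -- infinitesimal axisymmetry, components 0 and 1
  have hJ := hax.fderiv_rotGen hd
  rw [rotGen_eq_sub_single, map_sub, map_smul, map_smul] at hJ
  have hJ0 := congrArg (fun w : EuclideanSpace ℝ (Fin 3) => w 0) hJ
  have hJ1 := congrArg (fun w : EuclideanSpace ℝ (Fin 3) => w 1) hJ
  simp only [PiLp.sub_apply, PiLp.smul_apply, smul_eq_mul, rotGen_apply_zero, rotGen_apply_one] at hJ0 hJ1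
  -- no swirl
  have hS : x 0 * v x 1 - x 1 * v x 0 = 0 := hsw x
  -- linear algebra
  set a00 := fderiv ℝ v x (EuclideanSpace.single 0 1) 0
  set a01 := fderiv ℝ v x (EuclideanSpace.single 0 1) 1
  set a10 := fderiv ℝ v x (EuclideanSpace.single 1 1) 0
  set a11 := fderiv ℝ v x (EuclideanSpace.single 1 1) 1
  linear_combination (v x 0) * hJ1 - (v x 1) * hJ0 + (a10 - a01) * hS

/-! ### The regularised inverse square of the cylindrical radius -/

/-- The regularised weight `q_ε(x) = (x₀² + x₁² + ε²)⁻¹` is smooth for `ε ≠ 0`. [folklore] -/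
theorem contDiff_invSq {ε : ℝ} (hε : ε ≠ 0) {n : WithTop ℕ∞} :
    ContDiff ℝ n (fun x : EuclideanSpace ℝ (Fin 3) => (x 0 ^ 2 + x 1 ^ 2 + ε ^ 2)⁻¹) := by
  refine ContDiff.inv (((contDiff_coord 0).pow 2).add ((contDiff_coord 1).pow 2) |>.add contDiff_const) fun x => ?_
  positivity

/-- The derivative of the regularised weight: `D q_ε(x) w = −2 (x₀w₀ + x₁w₁) q_ε(x)²`; in particular
`∂_{x_h} q_ε = −2 r² q_ε²` and `∂₂ q_ε = 0`. [folklore] -/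
theorem fderiv_invSq {ε : ℝ} (hε : ε ≠ 0) (x w : EuclideanSpace ℝ (Fin 3)) :
    fderiv ℝ (fun y : EuclideanSpace ℝ (Fin 3) => (y 0 ^ 2 + y 1 ^ 2 + ε ^ 2)⁻¹) x w =
      -(2 * (x 0 * w 0 + x 1 * w 1)) * (x 0 ^ 2 + x 1 ^ 2 + ε ^ 2)⁻¹ ^ 2 := by
  have hp : 0 < x 0 ^ 2 + x 1 ^ 2 + ε ^ 2 := by positivity
  have h0 : HasFDerivAt (fun y : EuclideanSpace ℝ (Fin 3) => y 0) (EuclideanSpace.proj (𝕜 := ℝ) (0 : Fin 3)) x := by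
    simpa using (EuclideanSpace.proj (𝕜 := ℝ) (0 : Fin 3)).hasFDerivAt
  have h1 : HasFDerivAt (fun y : EuclideanSpace ℝ (Fin 3) => y 1) (EuclideanSpace.proj (𝕜 := ℝ) (1 : Fin 3)) x := by
    simpa using (EuclideanSpace.proj (𝕜 := ℝ) (1 : Fin 3)).hasFDerivAt
  have hP := ((h0.pow 2).add (h1.pow 2)).add_const (ε ^ 2)
  have hI : HasFDerivAt (fun y : EuclideanSpace ℝ (Fin 3) => (y 0 ^ 2 + y 1 ^ 2 + ε ^ 2)⁻¹)
      ((ContinuousLinearMap.toSpanSingleton ℝ (-((x 0 ^ 2 + x 1 ^ 2 + ε ^ 2) ^ 2)⁻¹)).comp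
        ((2 • x 0 ^ (2 - 1)) • EuclideanSpace.proj (𝕜 := ℝ) (0 : Fin 3) +
          (2 • x 1 ^ (2 - 1)) • EuclideanSpace.proj (𝕜 := ℝ) (1 : Fin 3))) x :=
    (hasFDerivAt_inv (𝕜 := ℝ) hp.ne').comp x hP
  rw [hI.fderiv]
  have e0 : (EuclideanSpace.proj (𝕜 := ℝ) (0 : Fin 3)) w = w 0 := rfl
  have e1 : (EuclideanSpace.proj (𝕜 := ℝ) (1 : Fin 3)) w = w 1 := rfl
  simp only [ContinuousLinearMap.comp_apply, ContinuousLinearMap.toSpanSingleton_apply, smul_apply,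
    add_apply, e0, e1, smul_eq_mul, nsmul_eq_mul]
  field_simp
  ring

/-! ### Calculus of the weighted products -/

/-- Components of a differentiable field are differentiable. [folklore] -/
theorem differentiableAt_apply_coord {v : EuclideanSpace ℝ (Fin 3) → EuclideanSpace ℝ (Fin 3)} {x : EuclideanSpace ℝ (Fin 3)}
    (hv : DifferentiableAt ℝ v x) (i : Fin 3) : DifferentiableAt ℝ (fun y => v y i) x := by
  have h : (fun y => v y i) = (EuclideanSpace.proj (𝕜 := ℝ) i) ∘ v := by
    ext y; simp
  rw [h]
  exact (EuclideanSpace.proj (𝕜 := ℝ) i).differentiableAt.comp x hv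

/-- The horizontal position field `y ↦ y₀e₀ + y₁e₁` is linear with derivative `w ↦ w₀e₀ + w₁e₁`. [folklore] -/
theorem hasFDerivAt_horizontal (x : EuclideanSpace ℝ (Fin 3)) :
    HasFDerivAt (fun y : EuclideanSpace ℝ (Fin 3) =>
        ((y 0) • EuclideanSpace.single 0 (1 : ℝ) + (y 1) • EuclideanSpace.single 1 (1 : ℝ) : EuclideanSpace ℝ (Fin 3)))
      ((EuclideanSpace.proj (𝕜 := ℝ) (0 : Fin 3)).smulRight (EuclideanSpace.single 0 (1 : ℝ) : EuclideanSpace ℝ (Fin 3)) +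
        (EuclideanSpace.proj (𝕜 := ℝ) (1 : Fin 3)).smulRight (EuclideanSpace.single 1 (1 : ℝ) : EuclideanSpace ℝ (Fin 3))) x :=
  by
  have h0 : HasFDerivAt (fun y : EuclideanSpace ℝ (Fin 3) => y 0) (EuclideanSpace.proj (𝕜 := ℝ) (0 : Fin 3)) x := by
    simpa using (EuclideanSpace.proj (𝕜 := ℝ) (0 : Fin 3)).hasFDerivAt
  have h1 : HasFDerivAt (fun y : EuclideanSpace ℝ (Fin 3) => y 1) (EuclideanSpace.proj (𝕜 := ℝ) (1 : Fin 3)) x := by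
    simpa using (EuclideanSpace.proj (𝕜 := ℝ) (1 : Fin 3)).hasFDerivAt
  exact (h0.smul_const (EuclideanSpace.single 0 (1 : ℝ) : EuclideanSpace ℝ (Fin 3))).fun_add
    (h1.smul_const (EuclideanSpace.single 1 (1 : ℝ) : EuclideanSpace ℝ (Fin 3)))

/-- The horizontal position field has divergence `2`. [folklore] -/
theorem divergence_horizontal (x : EuclideanSpace ℝ (Fin 3)) :
    VectorCalculus.divergence (fun y : EuclideanSpace ℝ (Fin 3) =>
      ((y 0) • EuclideanSpace.single 0 (1 : ℝ) + (y 1) • EuclideanSpace.single 1 (1 : ℝ) : EuclideanSpace ℝ (Fin 3))) x = 2 := by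
  rw [divergence_eq_sum_three, (hasFDerivAt_horizontal x).fderiv]
  have e0 : ∀ w : EuclideanSpace ℝ (Fin 3), (EuclideanSpace.proj (𝕜 := ℝ) (0 : Fin 3)) w = w 0 := fun w => rfl
  have e1 : ∀ w : EuclideanSpace ℝ (Fin 3), (EuclideanSpace.proj (𝕜 := ℝ) (1 : Fin 3)) w = w 1 := fun w => rfl
  simp [e0, e1]
  norm_num

/-- **Divergence of a weighted horizontal field**: for scalars `χ, W` differentiable at `x` and `ε ≠ 0`, with `q = (x₀²+x₁²+ε²)⁻¹`,
`div((χ q W) • x_h)(x) = 2 χ q W + (Dχ[x_h]) q W − 2 χ (x₀²+x₁²) q² W + χ q (DW[x_h])`. [folklore] -/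
theorem divergence_weighted_horizontal {χ W : EuclideanSpace ℝ (Fin 3) → ℝ} {x : EuclideanSpace ℝ (Fin 3)}
    (hχ : DifferentiableAt ℝ χ x) (hW : DifferentiableAt ℝ W x) {ε : ℝ} (hε : ε ≠ 0) :
    VectorCalculus.divergence (fun y => (χ y * (y 0 ^ 2 + y 1 ^ 2 + ε ^ 2)⁻¹ * W y) •
        ((y 0) • EuclideanSpace.single 0 (1 : ℝ) + (y 1) • EuclideanSpace.single 1 (1 : ℝ) : EuclideanSpace ℝ (Fin 3))) x =
      2 * (χ x * (x 0 ^ 2 + x 1 ^ 2 + ε ^ 2)⁻¹ * W x)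
        + fderiv ℝ χ x ((x 0) • EuclideanSpace.single 0 (1 : ℝ) + (x 1) • EuclideanSpace.single 1 (1 : ℝ))
            * (x 0 ^ 2 + x 1 ^ 2 + ε ^ 2)⁻¹ * W x
        - 2 * χ x * (x 0 ^ 2 + x 1 ^ 2) * ((x 0 ^ 2 + x 1 ^ 2 + ε ^ 2)⁻¹) ^ 2 * W x
        + χ x * (x 0 ^ 2 + x 1 ^ 2 + ε ^ 2)⁻¹ *
            fderiv ℝ W x ((x 0) • EuclideanSpace.single 0 (1 : ℝ) + (x 1) • EuclideanSpace.single 1 (1 : ℝ)) := by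
  have hq : DifferentiableAt ℝ (fun y : EuclideanSpace ℝ (Fin 3) => (y 0 ^ 2 + y 1 ^ 2 + ε ^ 2)⁻¹) x :=
    ((contDiff_invSq hε (n := 1)).differentiable one_ne_zero) x
  have hχq : DifferentiableAt ℝ (fun y => χ y * (y 0 ^ 2 + y 1 ^ 2 + ε ^ 2)⁻¹) x := hχ.fun_mul hq
  have hθ : DifferentiableAt ℝ (fun y => χ y * (y 0 ^ 2 + y 1 ^ 2 + ε ^ 2)⁻¹ * W y) x := hχq.fun_mul hW
  rw [divergence_smul_apply hθ (hasFDerivAt_horizontal x).differentiableAt, divergence_horizontal, real_inner_comm, gradient,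
    InnerProductSpace.toDual_symm_apply, fderiv_fun_mul hχq hW, fderiv_fun_mul hχ hq]
  simp only [add_apply, smul_apply, smul_eq_mul]
  rw [fderiv_invSq hε]
  simp
  ring

/-- **The `e₂`-derivative of `χ q v₂ h`** (`h = x₀v₀ + x₁v₁`, `q` independent of `x₂`):
`∂₂(χ q v₂ h) = (∂₂χ) q v₂ h + χ q (∂₂v₂) h + χ q v₂ (x₀∂₂v₀ + x₁∂₂v₁)`. [folklore] -/
theorem fderiv_weighted_product_two {v : EuclideanSpace ℝ (Fin 3) → EuclideanSpace ℝ (Fin 3)} {χ : EuclideanSpace ℝ (Fin 3) → ℝ}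
    {x : EuclideanSpace ℝ (Fin 3)} (hv : DifferentiableAt ℝ v x) (hχ : DifferentiableAt ℝ χ x) {ε : ℝ} (hε : ε ≠ 0) :
    fderiv ℝ (fun y => χ y * (y 0 ^ 2 + y 1 ^ 2 + ε ^ 2)⁻¹ * v y 2 * (y 0 * v y 0 + y 1 * v y 1)) x
        (EuclideanSpace.single 2 (1 : ℝ)) =
      fderiv ℝ χ x (EuclideanSpace.single 2 (1 : ℝ)) * (x 0 ^ 2 + x 1 ^ 2 + ε ^ 2)⁻¹ * v x 2 * (x 0 * v x 0 + x 1 * v x 1)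
        + χ x * (x 0 ^ 2 + x 1 ^ 2 + ε ^ 2)⁻¹ * fderiv ℝ v x (EuclideanSpace.single 2 (1 : ℝ)) 2 * (x 0 * v x 0 + x 1 * v x 1)
        + χ x * (x 0 ^ 2 + x 1 ^ 2 + ε ^ 2)⁻¹ * v x 2 *
            (x 0 * fderiv ℝ v x (EuclideanSpace.single 2 (1 : ℝ)) 0 + x 1 * fderiv ℝ v x (EuclideanSpace.single 2 (1 : ℝ)) 1) := by
  have hq : DifferentiableAt ℝ (fun y : EuclideanSpace ℝ (Fin 3) => (y 0 ^ 2 + y 1 ^ 2 + ε ^ 2)⁻¹) x :=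
    ((contDiff_invSq hε (n := 1)).differentiable one_ne_zero) x
  have hc' : ∀ i : Fin 3, HasFDerivAt (fun y : EuclideanSpace ℝ (Fin 3) => y i) (EuclideanSpace.proj (𝕜 := ℝ) i) x :=
    fun i => by simpa using (EuclideanSpace.proj (𝕜 := ℝ) i).hasFDerivAt
  have hc : ∀ i : Fin 3, DifferentiableAt ℝ (fun y : EuclideanSpace ℝ (Fin 3) => y i) x := fun i => (hc' i).differentiableAt
  have ec : ∀ (i : Fin 3) (w : EuclideanSpace ℝ (Fin 3)), fderiv ℝ (fun y : EuclideanSpace ℝ (Fin 3) => y i) x w = w i :=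
    fun i w => by rw [(hc' i).fderiv]; rfl
  have hvi : ∀ i : Fin 3, DifferentiableAt ℝ (fun y => v y i) x := fun i => differentiableAt_apply_coord hv i
  have h0 : DifferentiableAt ℝ (fun y : EuclideanSpace ℝ (Fin 3) => y 0 * v y 0) x := (hc 0).fun_mul (hvi 0)
  have h1 : DifferentiableAt ℝ (fun y : EuclideanSpace ℝ (Fin 3) => y 1 * v y 1) x := (hc 1).fun_mul (hvi 1)
  have hh : DifferentiableAt ℝ (fun y : EuclideanSpace ℝ (Fin 3) => y 0 * v y 0 + y 1 * v y 1) x := h0.fun_add h1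
  have hχq : DifferentiableAt ℝ (fun y => χ y * (y 0 ^ 2 + y 1 ^ 2 + ε ^ 2)⁻¹) x := hχ.fun_mul hq
  have hχqf : DifferentiableAt ℝ (fun y => χ y * (y 0 ^ 2 + y 1 ^ 2 + ε ^ 2)⁻¹ * v y 2) x := hχq.fun_mul (hvi 2)
  rw [fderiv_fun_mul hχqf hh, fderiv_fun_mul hχq (hvi 2), fderiv_fun_mul hχ hq, fderiv_fun_add h0 h1,
    fderiv_fun_mul (hc 0) (hvi 0), fderiv_fun_mul (hc 1) (hvi 1)]
  simp only [add_apply, smul_apply, smul_eq_mul]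
  rw [fderiv_invSq hε, fderiv_coord_apply hv 2, fderiv_coord_apply hv 0, fderiv_coord_apply hv 1, ec, ec]
  simp
  ring

/-- `D(½(v₀²+v₁²))(x) w = v₀ (Dv w)₀ + v₁ (Dv w)₁`, and differentiability. [folklore] -/
theorem fderiv_half_sq_horizontal {v : EuclideanSpace ℝ (Fin 3) → EuclideanSpace ℝ (Fin 3)} {x : EuclideanSpace ℝ (Fin 3)}
    (hv : DifferentiableAt ℝ v x) (w : EuclideanSpace ℝ (Fin 3)) :
    DifferentiableAt ℝ (fun y => 2⁻¹ * (v y 0 ^ 2 + v y 1 ^ 2)) x ∧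
      fderiv ℝ (fun y => 2⁻¹ * (v y 0 ^ 2 + v y 1 ^ 2)) x w = v x 0 * fderiv ℝ v x w 0 + v x 1 * fderiv ℝ v x w 1 := by
  have hvi : ∀ i : Fin 3, DifferentiableAt ℝ (fun y => v y i) x := fun i => differentiableAt_apply_coord hv i
  have h := (((hvi 0).hasFDerivAt.pow 2).fun_add ((hvi 1).hasFDerivAt.pow 2)).const_mul (2⁻¹ : ℝ)
  refine ⟨h.differentiableAt, ?_⟩
  rw [h.fderiv]
  simp only [smul_apply, add_apply, smul_eq_mul, nsmul_eq_mul]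
  rw [fderiv_coord_apply hv 0, fderiv_coord_apply hv 1]
  push_cast
  ring

/-- `D(½v₂²)(x) w = v₂ (Dv w)₂`, and differentiability. [folklore] -/
theorem fderiv_half_sq_two {v : EuclideanSpace ℝ (Fin 3) → EuclideanSpace ℝ (Fin 3)} {x : EuclideanSpace ℝ (Fin 3)}
    (hv : DifferentiableAt ℝ v x) (w : EuclideanSpace ℝ (Fin 3)) :
    DifferentiableAt ℝ (fun y => 2⁻¹ * v y 2 ^ 2) x ∧
      fderiv ℝ (fun y => 2⁻¹ * v y 2 ^ 2) x w = v x 2 * fderiv ℝ v x w 2 := by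
  have h := ((differentiableAt_apply_coord hv 2).hasFDerivAt.pow 2).const_mul (2⁻¹ : ℝ)
  refine ⟨h.differentiableAt, ?_⟩
  rw [h.fderiv]
  simp only [smul_apply, smul_eq_mul, nsmul_eq_mul]
  rw [fderiv_coord_apply hv 2]
  push_cast
  ring

/-! ### The pointwise decomposition of the regularised axial-flux integrand -/

/-- **The pointwise decomposition** (module docstring).  For `v ∈ C¹` axisymmetric, swirl-free, divergence-free, a `C¹` scalar `χ` and
`ε ≠ 0`, at every `x` (with `q = (x₀²+x₁²+ε²)⁻¹`, `f = v₂`, `h = x₀v₀ + x₁v₁`, `x_h = x₀e₀ + x₁e₁`):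
`χ q f · swirl(curl v) = χ q² (ε² f² + (x₀²+x₁²)(v₀²+v₁²)) + q (Dχ[x_h]) (f² − v₀² − v₁²)/2 − q h f (Dχ[e₂])`
`  + D(χ q f h)[e₂] + div(χ q (v₀²+v₁²)/2 • x_h) − div(χ q f²/2 • x_h)`. [folklore] -/
theorem axialFlux_integrand_decomposition {v : EuclideanSpace ℝ (Fin 3) → EuclideanSpace ℝ (Fin 3)} (hv : ContDiff ℝ 1 v)
    (hax : IsAxisymmetric v) (hsw : HasNoSwirl v) (hdiv : VectorCalculus.IsDivFree v)
    {χ : EuclideanSpace ℝ (Fin 3) → ℝ} (hχ : ContDiff ℝ 1 χ) {ε : ℝ} (hε : ε ≠ 0) (x : EuclideanSpace ℝ (Fin 3)) :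
    χ x * (x 0 ^ 2 + x 1 ^ 2 + ε ^ 2)⁻¹ * v x 2 * swirl (curl v) x =
      χ x * ((x 0 ^ 2 + x 1 ^ 2 + ε ^ 2)⁻¹) ^ 2 * (ε ^ 2 * v x 2 ^ 2 + (x 0 ^ 2 + x 1 ^ 2) * (v x 0 ^ 2 + v x 1 ^ 2))
      + ((x 0 ^ 2 + x 1 ^ 2 + ε ^ 2)⁻¹ * fderiv ℝ χ x ((x 0) • EuclideanSpace.single 0 (1 : ℝ) + (x 1) • EuclideanSpace.single 1 (1 : ℝ))
          * (2⁻¹ * (v x 2 ^ 2 - (v x 0 ^ 2 + v x 1 ^ 2)))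
        - (x 0 ^ 2 + x 1 ^ 2 + ε ^ 2)⁻¹ * (x 0 * v x 0 + x 1 * v x 1) * v x 2 * fderiv ℝ χ x (EuclideanSpace.single 2 (1 : ℝ)))
      + (fderiv ℝ (fun y => χ y * (y 0 ^ 2 + y 1 ^ 2 + ε ^ 2)⁻¹ * v y 2 * (y 0 * v y 0 + y 1 * v y 1)) x (EuclideanSpace.single 2 (1 : ℝ))
        + VectorCalculus.divergence (fun y => (χ y * (y 0 ^ 2 + y 1 ^ 2 + ε ^ 2)⁻¹ * (2⁻¹ * (v y 0 ^ 2 + v y 1 ^ 2))) •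
            ((y 0) • EuclideanSpace.single 0 (1 : ℝ) + (y 1) • EuclideanSpace.single 1 (1 : ℝ) : EuclideanSpace ℝ (Fin 3))) x
        - VectorCalculus.divergence (fun y => (χ y * (y 0 ^ 2 + y 1 ^ 2 + ε ^ 2)⁻¹ * (2⁻¹ * v y 2 ^ 2)) •
            ((y 0) • EuclideanSpace.single 0 (1 : ℝ) + (y 1) • EuclideanSpace.single 1 (1 : ℝ) : EuclideanSpace ℝ (Fin 3))) x) := by
  have hd : DifferentiableAt ℝ v x := (hv.differentiable one_ne_zero) x
  have hχd : DifferentiableAt ℝ χ x := (hχ.differentiable one_ne_zero) x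
  set xh : EuclideanSpace ℝ (Fin 3) := (x 0) • EuclideanSpace.single 0 (1 : ℝ) + (x 1) • EuclideanSpace.single 1 (1 : ℝ) with hxh
  obtain ⟨hW1, hW1'⟩ := fderiv_half_sq_horizontal hd xh
  obtain ⟨hW2, hW2'⟩ := fderiv_half_sq_two hd xh
  rw [divergence_weighted_horizontal hχd hW1 hε, divergence_weighted_horizontal hχd hW2 hε, hW1', hW2',
    fderiv_weighted_product_two hd hχd hε, swirl_curl_eq, hxh, fderiv_horizontal x 0, fderiv_horizontal x 1,
    fderiv_horizontal x 2]
  -- the three relations: the key identity, `div v = 0`, `q · (r² + ε²) = 1`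
  have hkey := horizontal_key_identity hax hsw hd
  have hdv : fderiv ℝ v x (EuclideanSpace.single 0 1) 0 + fderiv ℝ v x (EuclideanSpace.single 1 1) 1 +
      fderiv ℝ v x (EuclideanSpace.single 2 1) 2 = 0 := by
    rw [← divergence_eq_sum_three]; exact hdiv x
  have hP : 0 < x 0 ^ 2 + x 1 ^ 2 + ε ^ 2 := by positivity
  have hq : (x 0 ^ 2 + x 1 ^ 2 + ε ^ 2)⁻¹ * (x 0 ^ 2 + x 1 ^ 2 + ε ^ 2) = 1 := inv_mul_cancel₀ hP.ne'
  linear_combination (-(χ x * (x 0 ^ 2 + x 1 ^ 2 + ε ^ 2)⁻¹ * (x 0 * v x 0 + x 1 * v x 1))) * hdv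
    + (χ x * (x 0 ^ 2 + x 1 ^ 2 + ε ^ 2)⁻¹) * hkey
    + (-(χ x * (x 0 ^ 2 + x 1 ^ 2 + ε ^ 2)⁻¹ * v x 2 ^ 2)) * hq

end Summit.NavierStokesRegularity.NavierStokesRegularity.Theorems.PowerGaugeEulerLiouville.MirrorMoment

end
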